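import Literature.MathematicalPhysics.QuantumFieldTheory.Balaban1983to89.B4Ineq120RegularRegion
import Literature.MathematicalPhysics.QuantumFieldTheory.Balaban1983to89.B4Prop23ZeroRegion
import Literature.MathematicalPhysics.QuantumFieldTheory.Balaban1983to89.B1

/-!
# `Balaban1983to89.B4Prop23RegularFamily` — T. Bałaban, *Regularity and decay of lattice Green's functions*, Commun.
# Math. Phys. **89** (1983) 571–597 [Balaban1983RegularityDecay] (= B4): «Proposition 2.3 of [1]» (1.15)–(1.20) p. 574
# — the typed statement `B4.Prop23Printed` DISCHARGED ON THE FAMILY OF REGULAR-FIELD NESTED REGIONS (`A ≠ 0`)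

statement-level skeleton of published theorems with citation tags; proofs where landed; nothing here is a claim about the Yang–Mills mass gap

PDF held: `paper:balaban1983-cmp89-regularity-decay` (journal page = PDF page + 570); pp. 572–574, 593–594 [PDF 2–4,
23–24] read on the ×2 renders `…/b2b-balaban-ref1/pages/1983-cmp89-regularity-decay/…-p0NN-x2.png`.

CITATION HEADER (lean-in-tree rule).  Cell `lit-balaban` (HOME `run/shared/lean/pub/lit-balaban/`), Phase-2 proof seat
**p17** gen 3 (unit `lit-balaban-p17-g3`), file 5 = the LEAF of the MODEL INSTANCE of SKELETON row **B4.Prop2.3[I]**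
(`B4.Prop23Printed`, module `B4`, owner r01, referee ref-4) AT A REGULAR `A ≠ 0`.  The zero-field family was discharged by
b04 (`B4Prop23ZeroRegion.prop23Printed_zeroFieldRegions`); THIS MODULE builds the family of ALL regular-field instances on
nested finite unions of `L`-blocks and proves `Prop23Printed` for it from files 2–4 of this seat:
(1.15) = `B4Ineq53RegularRegion.{form115_lower_regular, form115_upper_regular}` ((5.1)–(5.3)), (1.16) + (1.17)–(1.18) =
`B4Prop23RegularRegion.prop23_116_118_regular`, (1.19)–(1.20) = `B4Ineq120RegularRegion.prop23_120_regular` (all by the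
printed §5 route pp. 593–594 on r01's `B4Prop23Sect5Route` and b04's Corollary 2.3 at `A ≠ 0`), the thresholds «e
sufficiently small» = b04's `B4Lower18Regular.threshold_exists`.

WHAT IS PRINTED (p. 574 [PDF 4], verbatim): *"Proposition 2.3 of [1]. There exist positive constants δ₀, c₀, γ₀, γ₁
dependent on d and M only and such that for arbitrary Λ ⊂ Ω^{(k)} = Ω∩Z^d, Λ being a sum of big blocks and for e
sufficiently small, we have γ₀I ≤ Δ^{(k)}(Ω,A) + aL^{−2}P(A) ≤ γ₁I, (1.15) |C^{(k)}_Λ(Ω,A; x,x′)| ≤ c₀exp(−δ₀|x−x′|), x, x′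
∈ Λ. (1.16) … |δC^{(k)}_Λ(Ω,A; x,x′)| ≤ c₀exp(−δ₀(|x−x′| + dist(x,Λ^c) + dist(x′,Λ^c))), x, x′ ∈ Λ. (1.18) Finally, for
Ω ⊂ Ω₀ and δC^{(k)}_Λ(Ω,Ω₀,A) = C^{(k)}_Λ(Ω,A) − C^{(k)}_Λ(Ω₀,A), (1.19) we have |δC^{(k)}_Λ(Ω,Ω₀,A; x,x′)| ≤
c₀exp(−δ₀(|x−x′| + dist(x,Ω^{(k)c}) + dist(x′,Ω^{(k)c}))), x, x′ ∈ Λ. (1.20)"*; the standing hypotheses are those of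
p. 572–573: *"We consider subsets Ω which are unions of big blocks"*, the regularity (1.7) *"|(∂^η_μA)(x)| ≤ ce^{β−1}, x ∈ Ω,
μ = 1,…,d, β > 0"*, *"for e sufficiently small"*.

THE FAMILY (`RegularRegionIdx`, `regularFieldRegions`; dictionary of files 1–4, lattice units, `d ↦ d+1`).  Fixed for the
family: `d`, the colour type `ι` (`N = |ι|`), an orthogonal flow `F` (`U(A) = F.U((e/n)·A)`), `L ≥ 1`, the constants `a_k = a
> 0` of `a_kP_k` and `a′ > 0` of `a′L^{−2}P` (written `a` in the print), the regularity constants `c ≥ 0`, `β > 0` of (1.7),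
and a mass window `m²₊`.  One INSTANCE = mesh `η = 1/n` (`n ≥ 1`); mass `m² ∈ [0, m²₊]`; NESTED label sets `Zc ⊆ Z₀c`
(`Ω^{(k)} = fineDom L Zc ⊆ Ω₀^{(k)} = fineDom L Z₀c`, finite unions of `L`-blocks of unit sites; fine regions `Ω ⊆ Ω₀`); an
ARBITRARY finite `Λ ⊆ Ω^{(k)} × {colours}`; the vector field `A_ν(x)` in component form on the whole fine lattice; the charge
`e`.  Carrier: `LSite = Λ`; `udist = |·|_∞` of the sites (`rhoY`); `distLc = dist_∞(·, (Ω^{(k)} × ι)∖Λ)` (`distCY`, `Λ^c` read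
inside `Ω^{(k)}` as in b04's `distCS`); `distOc = dist_∞(site, Ω₀^{(k)}∖Ω^{(k)})` (`omegaY`, b04's `dSet`); `kerC`, `kerDC`,
`kerDC0` = `|entry|` of `C^{(k)}_Λ(Ω,A)`, of `C^{(k)}_Λ(Ω,A) − C^{(k)}(Ω,A)`, of `C^{(k)}_Λ(Ω,A) − C^{(k)}_{ιΛ}(Ω₀,A)` with
`C^{(k)}_Λ(Ω,A) = cLam (hamR …Ω…) a (QkR …Ω…) a′ L^{−2} L^{d+1} (nextAvg …Zc…) Λ` ((1.13)–(1.14) in r01's plain-matrix language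
on b04's carriers, gen 2's dictionary) and `C^{(k)}_{ιΛ}(Ω₀,A)` THE SAME OBJECT BUILT ON `Ω₀`'S OWN CARRIERS at `ιΛ`, `ι` the
inclusion `Ω^{(k)} × ι ↪ Ω₀^{(k)} × ι` (`cLam_ambient_eq` identifies it with file 4's `cLam (ham0 …) …`); `form115 γ₀ γ₁` =
`γ₀‖ψ‖² ≤ ⟨ψ,(Δ^{(k)}(Ω,A) + a′L^{−2}P(A))ψ⟩ ≤ γ₁‖ψ‖²` for all `ψ`; `regular` = (1.7) in lattice units
`|A_ν(x+e_μ) − A_ν(x)| ≤ c e^{β−1}/n` for `x ∈ Ω₀` (fine points; as b04's `B4Cor23RegionEta`, the field must be regular on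
the AMBIENT region on which `G_k(Ω₀,A)` of (1.19) lives; instances with `Ω₀ = Ω` carry exactly the printed hypothesis);
`bigBlocks := True` (CARRIED AS TRIVIAL: no block structure of `Λ`, `Ω`, `Ω₀` beyond «unions of `L`-blocks» is needed).

WHAT IS KERNEL-CHECKED (zero `sorry`, standard axioms; no `Prop`-valued definition): `distCY` (+ `_nonneg`, `_le`); the
re-indexing `cLam_ambient_eq` (`C^{(k)}_{ιΛ}(Ω₀,A)(ιy,ιy′) = cLam H₀ … Λ y y′`, Mathlib `Matrix.inv_submatrix_equiv` + file 4a's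
entry identities); the threshold `hX_threshold`; **`prop23Printed_regularRegions`**: for a flow with `‖(U(t) − 1)v‖² ≤
(ℓt)²‖v‖²`, `L ≥ 1`, `a, a′ > 0`, `c ≥ 0`, `β > 0` and every `m²₊`, `B4.Prop23Printed (regularFieldRegions F hL a a′ c β m²₊)`
with the witnesses `γ₀ = gamLow`, `γ₁ = a + a′L^{−2}`, `c₀ = max(c116, c120)`, `δ₀ = min(d116, d120)` and `e₁` = the least
of three thresholds of `threshold_exists` (chosen BEFORE the instance); `prop23Printed_regularRegions_rot` (rotation
flow, `N = 2`, `ℓ = 1`: every flow hypothesis discharged); `prop23Intended_regularRegions` (B1's original Prop. 2.3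
(2.33)–(2.38), intended reading, via `B1.prop23Intended_iff_prop23Printed`); NON-VACUITY `linIdx_meets` (for every threshold the instance
with the NON-CONSTANT field `A_ν(x) = λx_0`, `λ = c e₁^{β−1}/n`, charge `e₁`, meets `regular` and `0 < e ≤ e₁`).

HONEST SCOPE.  (i) Finite nested block unions `Ω ⊆ Ω₀` (no infinite `Ω₀`, no torus); (1.7) on `Ω₀`; `R^N`-valued fields,
colour-resolved kernel entries; `|x−x′| = |·|_∞`; `Λ^c`, `Ω^{(k)c}` read inside `Ω^{(k)}`, `Ω₀^{(k)}` (b04's reading, as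
in `B4Prop23ZeroRegion.zeroFieldRegions`; for `Λ = Ω^{(k)} × ι` resp. `Ω₀ = Ω` the weights are `0` and the differences
vanish).  (ii) CONSTANTS: `δ₀, c₀, γ₀, γ₁, e₁` depend on `(d, N, L, a_k, a′, c, β, ℓ, m²₊)` — the printed «dependent on d and
M only» silently includes `L` (census C-B5-5, D-b04.4) and the fixed `a`, `a_k` («a_k is a constant proportional to a»);
uniformity over a WINDOW of `a_k` (which b04's zero-field family has) is NOT asserted here — each `a_k` is a separate
family.  (iii) The rate of (1.20) inherits b04's halving in the `δG` clause (D-b04g14-3).  (iv) `B4.Prop23Printed` is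
not a conjunct of `B4.LeafB4`; value = kernel certificate of a published proposition at `A ≠ 0` on b04/p35/r01/p17
objects, NOT summit progress.  Unit `lit-balaban-p17-g3`, HOME as above.
DOCFIX 2026-08-22 (lit-balaban-p17 gen 26, on r04 g22 `CITELOC-AUDIT-g22.md` §3, verified on the text layer of [Balaban1983RegularityDecay]): citation locators only — «(1.7) p.573» → «(1.7) p.572» at two `[cite:]` tags; every declaration byte-identical.
DOCFIX v1.2 2026-08-23 (lit-balaban-p17 gen 26, on r04 g44 INFO 05:51Z): the same slip at `regularFieldRegions` (:196, «(1.7) p.573» → «(1.7) p.572»), missed by the g22 audit՚s tag parser; declarations byte-identical.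
-/

namespace Literature.MathematicalPhysics.QuantumFieldTheory.Balaban1983to89.B4Prop23RegularFamily

open Finset Matrix
open Literature.MathematicalPhysics.QuantumFieldTheory.Balaban1983to89
open Literature.MathematicalPhysics.QuantumFieldTheory.Balaban1983to89.B4GaugeCovariance (OrthFlow)
open Literature.MathematicalPhysics.QuantumFieldTheory.Balaban1983to89.B4Lower18Regular (e1 e1_apply_self e1_apply_ne
  threshold_exists rot_lipschitz)
open Literature.MathematicalPhysics.QuantumFieldTheory.Balaban1983to89.B4Lower18 (fineDom)
open Literature.MathematicalPhysics.QuantumFieldTheory.Balaban1983to89.B4TwoRegion120 (fineDom_mono)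
open Literature.MathematicalPhysics.QuantumFieldTheory.Balaban1983to89.B4Cor23Region (c0R delta0R c0R_pos delta0R_pos)
open Literature.MathematicalPhysics.QuantumFieldTheory.Balaban1983to89.B4Cor23RegionDelta (c1R two_c0R_le_c1R)
open Literature.MathematicalPhysics.QuantumFieldTheory.Balaban1983to89.B4Sect5Torus (IsPseudoDist cSt dSt cSt_pos dSt_pos)
open Literature.MathematicalPhysics.QuantumFieldTheory.Balaban1983to89.B4GaussRep36 (deltaK pOp cOpLam cLam)
open Literature.MathematicalPhysics.QuantumFieldTheory.Balaban1983to89.B4Prop23ZeroBox (exp_bound_weaken)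
open Literature.MathematicalPhysics.QuantumFieldTheory.Balaban1983to89.B4Cor23Rep36Bridge (hamR QkR)
open Literature.MathematicalPhysics.QuantumFieldTheory.Balaban1983to89.B4NextAvg52 (nextAvg)
open Literature.MathematicalPhysics.QuantumFieldTheory.Balaban1983to89.B4Ineq53RegularRegion (gam0 gamLow gam0_pos gam0_anti
  gamLow_pos form115_lower_regular form115_upper_regular)
open Literature.MathematicalPhysics.QuantumFieldTheory.Balaban1983to89.B4Prop23RegularRegion (rhoY profK rhoY_isPseudoDist
  profK_nonneg c54 c116 d116 prop23_116_118_regular)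
open Literature.MathematicalPhysics.QuantumFieldTheory.Balaban1983to89.B4Ineq120RegularAmbient (inclι inclι_injective
  fine_sub ham0 deltaK_incl pOp_incl)
open Literature.MathematicalPhysics.QuantumFieldTheory.Balaban1983to89.B4Ineq120RegularRegion (omegaY omegaY_nonneg c55 c120
  d120 prop23_120_regular)

noncomputable section

variable {d : ℕ} {ι : Type} [Fintype ι] [DecidableEq ι]

/-! ## §1. The boundary weight `dist(x, Λ^c)` on `Y = Ω^{(k)} × {colours}` -/

/-- `dist(y, Λ^c) = inf{|y − z|_∞ : z ∈ Y∖Λ}` (`Λ^c` read inside `Y = Ω^{(k)} × {colours}`; `0` if `Λ = Y`).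
[cite: Balaban1983RegularityDecay, (1.18) p.574 «dist(x, Λ^c)», dictionary] -/
def distCY {L : ℕ} {Zc : Finset (Fin (d + 1) → ℤ)} (Λ : Finset (↥(fineDom L Zc) × ι)) (y : ↥(fineDom L Zc) × ι) : ℝ :=
  sInf ((fun z => rhoY L Zc y z) '' {z | z ∉ Λ})

omit [Fintype ι] [DecidableEq ι] in
/-- `dist(y, Λ^c) ≥ 0`. [cite: Balaban1983RegularityDecay, (1.18) p.574] -/
theorem distCY_nonneg {L : ℕ} {Zc : Finset (Fin (d + 1) → ℤ)} (Λ : Finset (↥(fineDom L Zc) × ι))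
    (y : ↥(fineDom L Zc) × ι) : 0 ≤ distCY Λ y := by
  unfold distCY
  apply Real.sInf_nonneg
  rintro _ ⟨z, -, rfl⟩
  exact (rhoY_isPseudoDist (ι := ι) Zc).nonneg y z

omit [Fintype ι] [DecidableEq ι] in
/-- `dist(y, Λ^c) ≤ |y − z|_∞` for `z ∉ Λ`. [cite: Balaban1983RegularityDecay, (1.18) p.574] -/
theorem distCY_le {L : ℕ} {Zc : Finset (Fin (d + 1) → ℤ)} (Λ : Finset (↥(fineDom L Zc) × ι))
    (y : ↥(fineDom L Zc) × ι) {z : ↥(fineDom L Zc) × ι} (hz : z ∉ Λ) : distCY Λ y ≤ rhoY L Zc y z := by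
  unfold distCY
  exact csInf_le ⟨0, by rintro _ ⟨w, -, rfl⟩; exact (rhoY_isPseudoDist (ι := ι) Zc).nonneg y w⟩ ⟨z, hz, rfl⟩

/-! ## §2. `C^{(k)}_{ιΛ}(Ω₀,A)` on `Ω₀`'s own carriers IS `cLam H₀ … Λ` of file 4 (re-indexing) -/

section Ambient

variable (F : OrthFlow ι) (e : ℝ) {n L : ℕ} (hn : 1 ≤ n) (hL : 1 ≤ L) (a m2 : ℝ) {Zc Z₀c : Finset (Fin (d + 1) → ℤ)}
  (hsub : Zc ⊆ Z₀c) (Ac : (Fin (d + 1) → ℤ) → Fin (d + 1) → ℝ)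

/-- the inclusion `ι : Ω^{(k)} × {colours} ↪ Ω₀^{(k)} × {colours}` as an embedding.
[cite: Balaban1983RegularityDecay, (1.19) p.574, dictionary] -/
def embY : (↥(fineDom L Zc) × ι) ↪ (↥(fineDom L Z₀c) × ι) :=
  ⟨inclι (fineDom_mono hL hsub), inclι_injective _⟩

/-- `ιΛ ⊆ Ω₀^{(k)} × {colours}` and the bijection `Λ ≃ ιΛ`. [cite: Balaban1983RegularityDecay, (1.19) p.574, dictionary] -/
def lamEquiv (Λ : Finset (↥(fineDom L Zc) × ι)) : ↥Λ ≃ ↥(Λ.map (embY (ι := ι) hL hsub)) :=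
  Equiv.ofBijective (fun y => ⟨embY hL hsub y.1, Finset.mem_map_of_mem _ y.2⟩)
    ⟨fun y y' h => Subtype.ext (inclι_injective (fineDom_mono hL hsub) (by simpa [embY] using congrArg Subtype.val h)),
      fun z => by
      obtain ⟨y, hy, hyz⟩ := Finset.mem_map.1 z.2
      exact ⟨⟨y, hy⟩, Subtype.ext hyz⟩⟩

variable {F e a m2 Ac} {ℓ : ℝ} (hℓ : 0 ≤ ℓ)
  (hLip : ∀ t (v : ι → ℝ), ((F.U t - 1) *ᵥ v) ⬝ᵥ ((F.U t - 1) *ᵥ v) ≤ (ℓ * t) ^ 2 * (v ⬝ᵥ v))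
  (he : 0 < e) (ha : 0 < a) (hm : 0 ≤ m2) {c β : ℝ} (hc : 0 ≤ c)
  (h17 : ∀ x ∈ fineDom n (fineDom L Z₀c), ∀ μ ν : Fin (d + 1), |Ac (x + e1 μ) ν - Ac x ν| ≤ c * e ^ (β - 1) / n)
  (hsmall : ℓ ^ 2 * ((d + 1) * c * e ^ β) ^ 2 * (d + 1) * (1 + a * (d + 1)) ≤ min 2 a / 4)

include hℓ hLip he ha hm hc h17 hsmall in
/-- **`C^{(k)}_{ιΛ}(Ω₀,A)(ιy, ιy′) = (cLam H₀ … Λ)(y, y′)`**: the propagator (1.13) of `Ω₀` at `ιΛ`, built on `Ω₀`'s own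
carriers, is entry-wise file 4's `cLam` with the form matrix `H₀` on `Ω`'s carriers (entry identities `deltaK_incl`,
`pOp_incl` + re-indexing of the inverse along `Λ ≃ ιΛ`). [cite: Balaban1983RegularityDecay, (1.13)–(1.14) p.573, (1.19) p.574] -/
theorem cLam_ambient_eq (s w : ℝ) (Λ : Finset (↥(fineDom L Zc) × ι)) (y y' : Λ) :
    cLam (hamR F e m2 (fineDom L Z₀c) Ac n) a (QkR F e hn (fineDom L Z₀c) Ac) s (((L : ℝ) ^ 2)⁻¹) w
        (nextAvg F (e / n) hL Z₀c n Ac) (Λ.map (embY hL hsub)) (lamEquiv hL hsub Λ y) (lamEquiv hL hsub Λ y')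
      = cLam (ham0 F e hn hL a m2 hsub Ac) a (QkR F e hn (fineDom L Zc) Ac) s (((L : ℝ) ^ 2)⁻¹) w
        (nextAvg F (e / n) hL Zc n Ac) Λ y y' := by
  have hK : (cOpLam (hamR F e m2 (fineDom L Z₀c) Ac n) a (QkR F e hn (fineDom L Z₀c) Ac) s (((L : ℝ) ^ 2)⁻¹) w
      (nextAvg F (e / n) hL Z₀c n Ac) (Λ.map (embY hL hsub))).submatrix (lamEquiv hL hsub Λ) (lamEquiv hL hsub Λ)
      = cOpLam (ham0 F e hn hL a m2 hsub Ac) a (QkR F e hn (fineDom L Zc) Ac) s (((L : ℝ) ^ 2)⁻¹) w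
        (nextAvg F (e / n) hL Zc n Ac) Λ := by
    have hE : ∀ r : Λ, ((lamEquiv hL hsub Λ r : ↥(Λ.map (embY (ι := ι) hL hsub))) : ↥(fineDom L Z₀c) × ι)
        = inclι (fineDom_mono hL hsub) r.1 := fun r => rfl
    ext p q
    unfold cOpLam
    rw [Matrix.submatrix_apply, Matrix.submatrix_apply, Matrix.submatrix_apply, hE, hE, Matrix.add_apply,
      Matrix.add_apply, Matrix.smul_apply, Matrix.smul_apply, deltaK_incl hn hL hsub hℓ hLip he ha hm hc h17 hsmall,
      pOp_incl F (e / n) hL hsub Ac]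
  unfold cLam
  rw [← hK, Matrix.inv_submatrix_equiv]
  rfl

end Ambient

/-! ## §3. The family of regular-field nested regions and its carrier -/

/-- ONE INSTANCE of «Proposition 2.3 of [1]» at a regular field: mesh `1/n`; mass `m² ∈ [0, m²₊]`; nested label sets
`Zc ⊆ Z₀c` (`Ω^{(k)} = fineDom L Zc ⊆ Ω₀^{(k)} = fineDom L Z₀c`); a finite `Λ ⊆ Ω^{(k)} × {colours}`; the vector field; the
charge. [cite: Balaban1983RegularityDecay, (1.13)–(1.20) pp.573–574, dictionary] -/
structure RegularRegionIdx (d : ℕ) (ι : Type) (L : ℕ) (m2max : ℝ) where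
  n : ℕ
  hn : 1 ≤ n
  m2 : ℝ
  hm : 0 ≤ m2
  hm' : m2 ≤ m2max
  Zc : Finset (Fin (d + 1) → ℤ)
  Z₀c : Finset (Fin (d + 1) → ℤ)
  hsub : Zc ⊆ Z₀c
  Λ : Finset (↥(fineDom L Zc) × ι)
  Ac : (Fin (d + 1) → ℤ) → Fin (d + 1) → ℝ
  e : ℝ

/-- **THE REGULAR-FIELD NESTED-REGION CARRIERS OF `B4.UnitSetting`** (module docstring, THE FAMILY).
[cite: Balaban1983RegularityDecay, (1.13)–(1.14) p.573, Prop. 2.3 of [1] (1.15)–(1.20) p.574, (1.7) p.572, dictionary] -/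
def regularFieldRegions (F : OrthFlow ι) {L : ℕ} (hL : 1 ≤ L) (a a' c β m2max : ℝ)
    (i : RegularRegionIdx d ι L m2max) : B4.UnitSetting where
  LSite := ↥i.Λ
  e := i.e
  regular := ∀ x ∈ fineDom i.n (fineDom L i.Z₀c), ∀ μ ν : Fin (d + 1),
    |i.Ac (x + e1 μ) ν - i.Ac x ν| ≤ c * i.e ^ (β - 1) / i.n
  bigBlocks := True
  udist := fun y y' => rhoY L i.Zc y.1 y'.1
  distLc := fun y => distCY i.Λ y.1
  distOc := fun y => omegaY L i.Zc i.Z₀c y.1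
  kerC := fun y y' => |cLam (hamR F i.e i.m2 (fineDom L i.Zc) i.Ac i.n) a (QkR F i.e i.hn (fineDom L i.Zc) i.Ac) a'
    (((L : ℝ) ^ 2)⁻¹) (((L ^ (d + 1) : ℕ) : ℝ)) (nextAvg F (i.e / i.n) hL i.Zc i.n i.Ac) i.Λ y y'|
  kerDC := fun y y' => |cLam (hamR F i.e i.m2 (fineDom L i.Zc) i.Ac i.n) a (QkR F i.e i.hn (fineDom L i.Zc) i.Ac) a'
      (((L : ℝ) ^ 2)⁻¹) (((L ^ (d + 1) : ℕ) : ℝ)) (nextAvg F (i.e / i.n) hL i.Zc i.n i.Ac) i.Λ y y'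
    - (B4GaussRep36.deltaK (hamR F i.e i.m2 (fineDom L i.Zc) i.Ac i.n) a (QkR F i.e i.hn (fineDom L i.Zc) i.Ac)
      + (a' * ((L : ℝ) ^ 2)⁻¹) • pOp (((L ^ (d + 1) : ℕ) : ℝ)) (nextAvg F (i.e / i.n) hL i.Zc i.n i.Ac))⁻¹ y.1 y'.1|
  kerDC0 := fun y y' => |cLam (hamR F i.e i.m2 (fineDom L i.Zc) i.Ac i.n) a (QkR F i.e i.hn (fineDom L i.Zc) i.Ac) a'
      (((L : ℝ) ^ 2)⁻¹) (((L ^ (d + 1) : ℕ) : ℝ)) (nextAvg F (i.e / i.n) hL i.Zc i.n i.Ac) i.Λ y y'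
    - cLam (hamR F i.e i.m2 (fineDom L i.Z₀c) i.Ac i.n) a (QkR F i.e i.hn (fineDom L i.Z₀c) i.Ac) a'
      (((L : ℝ) ^ 2)⁻¹) (((L ^ (d + 1) : ℕ) : ℝ)) (nextAvg F (i.e / i.n) hL i.Z₀c i.n i.Ac) (i.Λ.map (embY hL i.hsub))
      (lamEquiv hL i.hsub i.Λ y) (lamEquiv hL i.hsub i.Λ y')|
  form115 := fun γ₀ γ₁ => ∀ ψ : ↥(fineDom L i.Zc) × ι → ℝ,
    γ₀ * (ψ ⬝ᵥ ψ) ≤ ψ ⬝ᵥ ((B4GaussRep36.deltaK (hamR F i.e i.m2 (fineDom L i.Zc) i.Ac i.n) a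
        (QkR F i.e i.hn (fineDom L i.Zc) i.Ac) + (a' * ((L : ℝ) ^ 2)⁻¹) • pOp (((L ^ (d + 1) : ℕ) : ℝ))
        (nextAvg F (i.e / i.n) hL i.Zc i.n i.Ac)) *ᵥ ψ) ∧
      ψ ⬝ᵥ ((B4GaussRep36.deltaK (hamR F i.e i.m2 (fineDom L i.Zc) i.Ac i.n) a
        (QkR F i.e i.hn (fineDom L i.Zc) i.Ac) + (a' * ((L : ℝ) ^ 2)⁻¹) • pOp (((L ^ (d + 1) : ℕ) : ℝ))
        (nextAvg F (i.e / i.n) hL i.Zc i.n i.Ac)) *ᵥ ψ) ≤ γ₁ * (ψ ⬝ᵥ ψ)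

/-! ## §4. The thresholds «for e sufficiently small» -/

/-- the threshold of file 2's `hX` (the cross term of (1.22) below `γ₀″`), uniform on the mass window: `γ₀(a,m²)·6(d+1)
(a/γ(m²))²(ℓ(3d+4)c e^β)² ≤ γ₀″` for `0 < e ≤ e₁`, all `m² ∈ [0,m²₊]`. [cite: Balaban1983RegularityDecay, (1.22) p.574, (5.2)–(5.3) p.593 «for e sufficiently small»] -/
theorem hX_threshold (ℓ c : ℝ) {a : ℝ} (ha : 0 < a) {a' : ℝ} (ha' : 0 < a') {β : ℝ} (hβ : 0 < β) (d L : ℕ)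
    (hL : 1 ≤ L) (m2max : ℝ) :
    ∃ e₁ : ℝ, 0 < e₁ ∧ ∀ e : ℝ, 0 < e → e ≤ e₁ → ∀ m2 : ℝ, 0 ≤ m2 →
      gam0 d a m2 * (6 * (d + 1) * (a / (min 2 a / 4 + m2)) ^ 2 * (ℓ * ((3 * d + 4) * c * e ^ β)) ^ 2)
        ≤ gamLow d L a a' m2max := by
  set Kx : ℝ := gam0 d a 0 * (6 * (d + 1) * (a / (min 2 a / 4)) ^ 2 * (ℓ * ((3 * d + 4) * c)) ^ 2) with hKx
  have hγ := gamLow_pos d hL a ha' m2max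
  have hKx0 : 0 ≤ Kx := by have := gam0_pos d a 0; positivity
  obtain ⟨e₁, he₁, h⟩ := threshold_exists 1 (Real.sqrt Kx) (mul_pos four_pos hγ) hβ 0
  refine ⟨e₁, he₁, fun e he hle m2 hm => ?_⟩
  have h1 := h e he hle
  simp only [Nat.cast_zero, zero_add, mul_one, one_pow, one_mul] at h1
  have hmin : min 2 (4 * gamLow d L a a' m2max) / 4 ≤ gamLow d L a a' m2max := by
    have := min_le_right (2 : ℝ) (4 * gamLow d L a a' m2max); linarith
  have hsq : (Real.sqrt Kx * e ^ β) ^ 2 = Kx * (e ^ β) ^ 2 := by rw [mul_pow, Real.sq_sqrt hKx0]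
  have h2 : Kx * (e ^ β) ^ 2 ≤ gamLow d L a a' m2max := by
    have h3 : (Real.sqrt Kx * e ^ β) ^ 2 ≤ (Real.sqrt Kx * e ^ β) ^ 2 * (1 + 4 * gamLow d L a a' m2max) :=
      le_mul_of_one_le_right (sq_nonneg _) (by linarith)
    linarith
  have hσ : 0 < min 2 a / 4 := div_pos (lt_min two_pos ha) four_pos
  have hg : gam0 d a m2 ≤ gam0 d a 0 := gam0_anti d ha hm
  have hq : a / (min 2 a / 4 + m2) ≤ a / (min 2 a / 4) := div_le_div_of_nonneg_left ha.le hσ (by linarith)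
  have hq0 : 0 ≤ a / (min 2 a / 4 + m2) := by positivity
  calc _ ≤ gam0 d a 0 * (6 * (d + 1) * (a / (min 2 a / 4)) ^ 2 * (ℓ * ((3 * d + 4) * c * e ^ β)) ^ 2) := by
        have h0 : 0 ≤ 6 * ((d : ℝ) + 1) * (a / (min 2 a / 4 + m2)) ^ 2 * (ℓ * ((3 * d + 4) * c * e ^ β)) ^ 2 := by
          positivity
        refine mul_le_mul hg (mul_le_mul_of_nonneg_right (mul_le_mul_of_nonneg_left (pow_le_pow_left₀ hq0 hq 2)
          (by positivity)) (sq_nonneg _)) h0 (gam0_pos d a 0).le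
    _ = Kx * (e ^ β) ^ 2 := by rw [hKx]; ring
    _ ≤ _ := h2

/-! ## §5. The leaf: `B4.Prop23Printed` on the regular-field family -/

section Leaf

variable (F : OrthFlow ι) {ℓ : ℝ} (hℓ : 0 ≤ ℓ)
  (hLip : ∀ t (v : ι → ℝ), ((F.U t - 1) *ᵥ v) ⬝ᵥ ((F.U t - 1) *ᵥ v) ≤ (ℓ * t) ^ 2 * (v ⬝ᵥ v))
  {L : ℕ} (hL : 1 ≤ L) {a : ℝ} (ha : 0 < a) {a' : ℝ} (ha' : 0 < a') {c : ℝ} (hc : 0 ≤ c) {β : ℝ} (hβ : 0 < β)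
  (m2max : ℝ)

include hℓ hLip ha ha' hc hβ in
/-- **LEAF: «PROPOSITION 2.3 OF [1]» (1.15)–(1.20) HOLDS ON THE FAMILY OF REGULAR-FIELD NESTED REGIONS (`A ≠ 0`)** —
`B4.Prop23Printed (regularFieldRegions F hL a_k a′ c β m²₊)`: for a Lipschitz orthogonal flow, `L ≥ 1`, `a_k, a′ > 0`,
`c ≥ 0`, `β > 0` THERE EXIST `δ₀, c₀, γ₀, γ₁, e₁ > 0` (explicit: `γ₀ = γ₀″ = gamLow`, `γ₁ = a_k + a′L^{−2}`, `c₀ = max(c116,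
c120)`, `δ₀ = min(d116, d120)`, `e₁` from `threshold_exists`) such that for EVERY instance — every mesh, every `m² ∈
[0,m²₊]`, every nested pair `Ω ⊆ Ω₀` of finite unions of `L`-blocks, EVERY `Λ ⊆ Ω^{(k)} × {colours}`, every vector field
regular (1.7) on `Ω₀`, every charge `0 < e ≤ e₁` — (1.15), (1.16), (1.17)–(1.18) and (1.19)–(1.20) hold, by the printed §5
route (files 2–4 of this seat on r01's `B4Prop23Sect5Route`, b04's Corollary 2.3 at `A ≠ 0`, p35's (1.22)).
[cite: Balaban1983RegularityDecay, Prop. 2.3 of [1] (1.15)–(1.20) p.574; §5 pp.593–594] -/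
theorem prop23Printed_regularRegions : B4.Prop23Printed (regularFieldRegions (d := d) F hL a a' c β m2max) := by
  have hL0 : (0 : ℝ) < L := by exact_mod_cast hL
  have hγ := gamLow_pos d hL a ha' m2max
  have hag : 0 < a' / gam0 d a m2max := div_pos ha' (gam0_pos d a m2max)
  obtain ⟨e₁, he₁, h₁⟩ := threshold_exists ℓ ((d + 1) * c) ha hβ d
  obtain ⟨e₂, he₂, h₂⟩ := threshold_exists ℓ ((d + 1) * ((L : ℝ) ^ 2 * c)) hag hβ d
  obtain ⟨e₃, he₃, h₃⟩ := hX_threshold ℓ c ha ha' hβ d L hL m2max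
  have hC1 : 0 ≤ c1R d a := by linarith [two_c0R_le_c1R d ha, c0R_pos ha]
  have hc54 : 0 ≤ c54 d L a a' := by
    unfold c54; have := c0R_pos ha; positivity
  have hc55 : 0 ≤ c55 d L a a' := by unfold c55; positivity
  have hK := profK_nonneg (ι := ι) (d := d)
  have hc116 : 0 < c116 ι d L a a' m2max := cSt_pos _ _ _ hγ
  have hd116 : 0 < d116 ι d L a a' m2max := dSt_pos hK hγ hc54 (delta0R_pos d ha)
  have hd120 : 0 < d120 ι d L a a' m2max := dSt_pos hK hγ hc55 (half_pos (delta0R_pos d ha))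
  refine ⟨min (d116 ι d L a a' m2max) (d120 ι d L a a' m2max), max (c116 ι d L a a' m2max) (c120 ι d L a a' m2max),
    gamLow d L a a' m2max, a + a' * ((L : ℝ) ^ 2)⁻¹, min e₁ (min e₂ e₃), lt_min hd116 hd120, lt_max_of_lt_left hc116,
    hγ, by positivity, lt_min he₁ (lt_min he₂ he₃), ?_⟩
  intro i hreg _ he hle
  change 0 < i.e at he
  change i.e ≤ _ at hle
  change ∀ x ∈ fineDom i.n (fineDom L i.Z₀c), ∀ μ ν : Fin (d + 1), |i.Ac (x + e1 μ) ν - i.Ac x ν| ≤ c * i.e ^ (β - 1) / i.n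
    at hreg
  -- the smallness hypotheses of files 2–4 at the charge of the instance
  have hsmall : ℓ ^ 2 * ((d + 1) * c * i.e ^ β) ^ 2 * (d + 1) * (1 + a * (d + 1)) ≤ min 2 a / 4 := by
    have := h₁ i.e he (hle.trans (min_le_left _ _)); simpa only [mul_assoc] using this
  have hsmallU : ℓ ^ 2 * ((d + 1) * ((L : ℝ) ^ 2 * c) * i.e ^ β) ^ 2 * (d + 1)
      * (1 + (a' / gam0 d a m2max) * (d + 1)) ≤ min 2 (a' / gam0 d a m2max) / 4 := by
    have := h₂ i.e he (hle.trans ((min_le_right _ _).trans (min_le_left _ _)))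
    simpa only [mul_assoc] using this
  have hX := h₃ i.e he (hle.trans ((min_le_right _ _).trans (min_le_right _ _))) i.m2 i.hm
  have h17 : ∀ x ∈ fineDom i.n (fineDom L i.Zc), ∀ μ ν : Fin (d + 1),
      |i.Ac (x + e1 μ) ν - i.Ac x ν| ≤ c * i.e ^ (β - 1) / i.n := fun x hx => hreg x (fine_sub i.hn hL i.hsub hx)
  refine ⟨fun ψ => ⟨?_, ?_⟩, fun y y' => ?_, fun y y' => ?_, fun y y' => ?_⟩
  · -- (1.15), lower
    exact form115_lower_regular F hℓ hLip he i.hn hL ha ha' i.hm i.hm' i.Zc hc h17 hsmall hsmallU hX ψ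
  · -- (1.15), upper
    exact form115_upper_regular F hℓ hLip he i.hn hL ha ha' i.hm i.Zc hc h17 hsmall ψ
  · -- (1.16)
    have h := (prop23_116_118_regular F hℓ hLip he i.hn hL ha ha' i.hm i.hm' i.Zc hc h17 hsmall hsmallU hX i.Λ).1 y y'
    exact h.trans (exp_bound_weaken ((rhoY_isPseudoDist (ι := ι) i.Zc).nonneg _ _) hc116.le (le_max_left _ _)
      (min_le_left _ _))
  · -- (1.17)–(1.18)
    have h := (prop23_116_118_regular F hℓ hLip he i.hn hL ha ha' i.hm i.hm' i.Zc hc h17 hsmall hsmallU hX i.Λ).2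
      (fun y => distCY i.Λ y.1) (fun y => distCY_nonneg i.Λ y.1) (fun y z hz => distCY_le i.Λ y.1 hz) y y'
    refine h.trans (exp_bound_weaken ?_ hc116.le (le_max_left _ _) (min_le_left _ _))
    have := (rhoY_isPseudoDist (ι := ι) i.Zc).nonneg y.1 y'.1
    have := distCY_nonneg i.Λ y.1
    have := distCY_nonneg i.Λ y'.1
    positivity
  · -- (1.19)–(1.20)
    have h := prop23_120_regular i.hn hL i.hsub F hℓ hLip he ha ha' i.hm i.hm' hc hreg hsmall hsmallU hX i.Λ y y'
    show |_ - cLam _ _ _ _ _ _ _ _ (lamEquiv hL i.hsub i.Λ y) (lamEquiv hL i.hsub i.Λ y')| ≤ _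
    rw [cLam_ambient_eq i.hn hL i.hsub hℓ hLip he ha i.hm hc hreg hsmall]
    refine h.trans (exp_bound_weaken ?_ (cSt_pos _ _ _ hγ).le (le_max_right _ _) (min_le_right _ _))
    have := (rhoY_isPseudoDist (ι := ι) i.Zc).nonneg y.1 y'.1
    have := omegaY_nonneg (Z₀c := i.Z₀c) y.1
    have := omegaY_nonneg (Z₀c := i.Z₀c) y'.1
    positivity

end Leaf

/-- **THE LEAF FOR THE ROTATION FLOW** (`N = 2`, `U(t)` = rotation by `t`, `ℓ = 1`): a hypothesis-free instance of the
flow assumptions. [cite: Balaban1983RegularityDecay, Prop. 2.3 of [1] (1.15)–(1.20) p.574] -/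
theorem prop23Printed_regularRegions_rot {L : ℕ} (hL : 1 ≤ L) {a : ℝ} (ha : 0 < a) {a' : ℝ} (ha' : 0 < a')
    {c : ℝ} (hc : 0 ≤ c) {β : ℝ} (hβ : 0 < β) (m2max : ℝ) :
    B4.Prop23Printed (regularFieldRegions (d := d) OrthFlow.rot hL a a' c β m2max) :=
  prop23Printed_regularRegions OrthFlow.rot zero_le_one rot_lipschitz hL ha ha' hc hβ m2max

/-- **B1 PROPOSITION 2.3 (2.33)–(2.38) [Balaban1982Higgs1, pp. 611–612] AT A REGULAR `A ≠ 0`, INTENDED READING** (the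
original of «Proposition 2.3 of [1]»; `B1.Prop23Intended` = `B4.Prop23Printed` clause for clause, r14/pv07's
`B1.prop23Intended_iff_prop23Printed`): holds on the regular-field family. [cite: Balaban1982Higgs1, Prop. 2.3 (2.33)–(2.38) pp.611–612] -/
theorem prop23Intended_regularRegions (F : OrthFlow ι) {ℓ : ℝ} (hℓ : 0 ≤ ℓ)
    (hLip : ∀ t (v : ι → ℝ), ((F.U t - 1) *ᵥ v) ⬝ᵥ ((F.U t - 1) *ᵥ v) ≤ (ℓ * t) ^ 2 * (v ⬝ᵥ v))
    {L : ℕ} (hL : 1 ≤ L) {a : ℝ} (ha : 0 < a) {a' : ℝ} (ha' : 0 < a') {c : ℝ} (hc : 0 ≤ c) {β : ℝ} (hβ : 0 < β)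
    (m2max : ℝ) : B1.Prop23Intended (regularFieldRegions (d := d) F hL a a' c β m2max) :=
  (B1.prop23Intended_iff_prop23Printed _).2 (prop23Printed_regularRegions F hℓ hLip hL ha ha' hc hβ m2max)

/-! ## §6. Non-vacuity: the antecedents are met below every threshold by a non-constant field -/

/-- THE LINEAR-FIELD INSTANCE: mesh `1/n`, given nested label sets and `Λ`, mass `m²`, charge `e`, and the NON-CONSTANT
vector field `A_ν(x) = λx_0`. [cite: Balaban1983RegularityDecay, (1.7) p.572, dictionary] -/
def linIdx {L : ℕ} {m2max : ℝ} {n : ℕ} (hn : 1 ≤ n) {m2 : ℝ} (hm : 0 ≤ m2) (hm' : m2 ≤ m2max)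
    {Zc Z₀c : Finset (Fin (d + 1) → ℤ)} (hsub : Zc ⊆ Z₀c) (Λ : Finset (↥(fineDom L Zc) × ι)) (lam e : ℝ) :
    RegularRegionIdx d ι L m2max where
  n := n
  hn := hn
  m2 := m2
  hm := hm
  hm' := hm'
  Zc := Zc
  Z₀c := Z₀c
  hsub := hsub
  Λ := Λ
  Ac := fun x _ => lam * ((x 0 : ℤ) : ℝ)
  e := e

/-- **NON-VACUITY**: for EVERY threshold `e₁ > 0`, every mesh, mass, nested pair and `Λ`, the linear-field instance with
charge `e₁` and slope `λ = c e₁^{β−1}/n` meets `regular`, `bigBlocks` and `0 < e ≤ e₁` — the threshold excludes no scale,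
region or mass, and the conclusion is asserted for genuinely non-zero fields. [cite: Balaban1983RegularityDecay, (1.7) p.572] -/
theorem linIdx_meets (F : OrthFlow ι) {L : ℕ} (hL : 1 ≤ L) (a a' : ℝ) {c : ℝ} (hc : 0 ≤ c) (β m2max : ℝ) {n : ℕ}
    (hn : 1 ≤ n) {m2 : ℝ} (hm : 0 ≤ m2) (hm' : m2 ≤ m2max) {Zc Z₀c : Finset (Fin (d + 1) → ℤ)} (hsub : Zc ⊆ Z₀c)
    (Λ : Finset (↥(fineDom L Zc) × ι)) {e₁ : ℝ} (he₁ : 0 < e₁) :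
    (regularFieldRegions F hL a a' c β m2max (linIdx hn hm hm' hsub Λ (c * e₁ ^ (β - 1) / n) e₁)).regular ∧
      (regularFieldRegions F hL a a' c β m2max (linIdx hn hm hm' hsub Λ (c * e₁ ^ (β - 1) / n) e₁)).bigBlocks ∧
      0 < (regularFieldRegions F hL a a' c β m2max (linIdx hn hm hm' hsub Λ (c * e₁ ^ (β - 1) / n) e₁)).e ∧
      (regularFieldRegions F hL a a' c β m2max (linIdx hn hm hm' hsub Λ (c * e₁ ^ (β - 1) / n) e₁)).e ≤ e₁ := by
  refine ⟨?_, trivial, he₁, le_rfl⟩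
  intro x _ μ ν
  show |c * e₁ ^ (β - 1) / n * (((x + e1 μ) 0 : ℤ) : ℝ) - c * e₁ ^ (β - 1) / n * ((x 0 : ℤ) : ℝ)| ≤ c * e₁ ^ (β - 1) / n
  have hlam : 0 ≤ c * e₁ ^ (β - 1) / n := by positivity
  rw [← mul_sub, abs_mul, abs_of_nonneg hlam]
  apply mul_le_of_le_one_right hlam
  simp only [Pi.add_apply, Int.cast_add, add_sub_cancel_left]
  by_cases h : (0 : Fin (d + 1)) = μ
  · subst h; rw [e1_apply_self]; simp
  · rw [e1_apply_ne h]; simp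

end

end Literature.MathematicalPhysics.QuantumFieldTheory.Balaban1983to89.B4Prop23RegularFamily
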